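import Mathlib
import Summits.CriticalPhenomena.CardyFormulaZ2.Theses.CardyIKTransport

/-!
# Sketch (crux-ideate, ideator 3, round 1) — first lemmas of three idea cards for the crux
`IKMixedBoxCrossing` (stmt-CriticalPhenomena-5911)

The mixed IK / site-𝕋 colour model is re-declared here with the crux's own let-bound terms
(`μ`, `par`, `blk`, `anti`, `edges`), so that the first lemmas below are statements about the
very object quantified in `Summit.CriticalPhenomena.CardyFormulaZ2.Theses.CardyIKTransport.IKMixedBoxCrossing`.

* Card `dobrushin-fresh-collar-rsw`: `dobrushin_row_sum_lt_one` (PROVED: the Dobrushin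
  interdependence row sum of the t = √3/2 plaquette field is 4/7 + 4(7-4√3) < 1) and the named
  first lemma `MixedExpDecorrelation` (exponential decorrelation of colour events, uniform in S).
* Card `xor-corner-conditional-duality`: `XorCornerQuasiInvariance` (the joint law of
  (colours, diagonals) is quasi-invariant, density ≤ 16/9, under XOR of the colours by the
  indicator of any cell rectangle, uniformly in S).
* Card `curtain-contact-gluing`: `CurtainIndependence` (colours left and right of a face-column
  x₀ ∉ S are independent).
-/

namespace Summit.CriticalPhenomena.CardyFormulaZ2.Cruxes.IKMixedBoxCrossing.Ideator3

open MeasureTheory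
open scoped Classical
open Literature.Probability.LatticeModels Literature.Probability.Percolation

/-- The sample space of the i.i.d.-bit gauge (A-bits, B-bits, biased plaquettes, fair plaquettes, coins). -/
abbrev Ω : Type :=
  Set ℤ × (Set ℤ × (Set (Site 2) × (Set (Site 2) × Set (Site 2))))

/-- The product measure of the crux (verbatim). -/
noncomputable def μ : Measure Ω :=
  (sitePercolation ℤ half).prod ((sitePercolation ℤ half).prod
    ((sitePercolation (Site 2) (Set.projIcc (0:ℝ) 1 zero_le_one (2 * Real.sqrt 3 - 3))).prod
      ((sitePercolation (Site 2) half).prod (sitePercolation (Site 2) half))))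

/-- Plaquette defect at face `f` (biased field on S-columns, fair elsewhere) — verbatim. -/
def par (S : Set ℤ) (ω : Ω) (f : Site 2) : Prop :=
  (f 0 ∈ S ∧ f ∈ ω.2.2.1) ∨ (f 0 ∉ S ∧ f ∈ ω.2.2.2.1)

/-- Colour of cell `v` — verbatim. -/
def blk (S : Set ℤ) (ω : Ω) (v : Site 2) : Prop :=
  Xor (v 0 ∈ ω.1) (Xor (v 1 ∈ ω.2.1)
    (Odd ((Finset.filter (fun f : ℤ × ℤ => par S ω ![f.1, f.2])
      (Finset.Ico (min 0 (v 0)) (max 0 (v 0)) ×ˢ Finset.Ico (min 0 (v 1)) (max 0 (v 1)))).card)))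

/-- Anti-diagonal chosen at face `f` — verbatim. -/
def anti (S : Set ℤ) (ω : Ω) (f : Site 2) : Prop := f 0 ∉ S ∨ f ∈ ω.2.2.2.2

/-- The open bond configuration on the cells — verbatim. -/
def edges (S : Set ℤ) (ω : Ω) : BondConfig (Site 2) :=
  {e | ∃ u v, e = s(u, v) ∧ blk S ω u ∧ blk S ω v ∧ (v = u + ![1, 0] ∨ v = u + ![0, 1] ∨
    (v = u + ![1, 1] ∧ ¬ anti S ω u) ∨ (v = u + ![1, -1] ∧ anti S ω (u + ![0, -1])))}

/-- Sanity: the crux is the uniform long-way box-crossing bound for THIS `edges`/`μ`. -/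
example : Theses.CardyIKTransport.IKMixedBoxCrossing ↔
    ∃ c : ℝ, 0 < c ∧ ∀ S : Set ℤ, ∀ n : ℕ, 1 ≤ n → ∀ a b : ℤ,
      c ≤ μ.real {ω | edges S ω ∈ openCrossing {v | a ≤ v 0 ∧ v 0 < a + 2 * n ∧ b ≤ v 1 ∧ v 1 < b + n}
        {v | v 0 = a ∧ b ≤ v 1 ∧ v 1 < b + n} {v | v 0 = a + 2 * n - 1 ∧ b ≤ v 1 ∧ v 1 < b + n}} ∧
      c ≤ μ.real {ω | edges S ω ∈ openCrossing {v | a ≤ v 0 ∧ v 0 < a + n ∧ b ≤ v 1 ∧ v 1 < b + 2 * n}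
        {v | v 1 = b ∧ a ≤ v 0 ∧ v 0 < a + n} {v | v 1 = b + 2 * n - 1 ∧ a ≤ v 0 ∧ v 0 < a + n}} := by
  simp only [Theses.CardyIKTransport.IKMixedBoxCrossing, μ, edges, blk, anti, par]

/-! ## Card A — Dobrushin freshness -/

/-- The Dobrushin interdependence row sum of the corner-fugacity-`t` plaquette field on the Moore
lattice: a nearest neighbour shares two plaquettes with the cell (odds change by `t^{±4}`, total
variation ≤ (1-t²)/(1+t²)), a diagonal neighbour shares one (odds `t^{±2}`, TV ≤ (1-t)/(1+t)). -/
noncomputable def dobrushinRowSum (t : ℝ) : ℝ :=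
  4 * ((1 - t ^ 2) / (1 + t ^ 2)) + 4 * ((1 - t) / (1 + t))

/-- At the isotropic IK point `t = √3/2` the row sum is `4/7 + 4(7 - 4√3) = 0.8586… < 1`:
Dobrushin's uniqueness condition holds (and a fortiori on mixed patterns, where `t = 1` columns
contribute 0). PROVED. -/
theorem dobrushin_row_sum_lt_one : dobrushinRowSum (Real.sqrt 3 / 2) < 1 := by
  unfold dobrushinRowSum
  have hs : Real.sqrt 3 ^ 2 = 3 := Real.sq_sqrt (by norm_num)
  have hs0 : 0 ≤ Real.sqrt 3 := Real.sqrt_nonneg 3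
  have hlow : (1.7 : ℝ) < Real.sqrt 3 := by
    rw [show (1.7:ℝ) = Real.sqrt (1.7 ^ 2) by rw [Real.sqrt_sq (by norm_num)]]
    exact Real.sqrt_lt_sqrt (by norm_num) (by norm_num)
  have h1 : (1 - (Real.sqrt 3 / 2) ^ 2) / (1 + (Real.sqrt 3 / 2) ^ 2) = 1 / 7 := by
    rw [div_pow, hs]; norm_num
  have hpos : 0 < 1 + Real.sqrt 3 / 2 := by positivity
  have h2 : (1 - Real.sqrt 3 / 2) / (1 + Real.sqrt 3 / 2) < 3 / 28 := by
    rw [div_lt_iff₀ hpos]; nlinarith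
  rw [h1]; linarith

/-- Colours observed on a finite set of cells. -/
def obsOn (S : Set ℤ) (Λ : Finset (Site 2)) (ω : Ω) : Λ → Prop := fun v => blk S ω v

/-- **First lemma of card A (named, not proved): exponential decorrelation uniform in `S`.**
Colour events supported on finite cell sets at sup-distance `≥ r` decorrelate like
`C · |Λ₁| · e^{-c r}`, with `C, c` independent of the column pattern `S` — the covariance form of
Dobrushin's comparison theorem (row sum `< 1` above) / van den Berg–Maes disagreement percolation
(single-site disagreement `7/25 < p_c^site(Moore) ≥ 0.3205`). -/
def MixedExpDecorrelation : Prop :=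
  ∃ C c : ℝ, 0 < c ∧ ∀ S : Set ℤ, ∀ Λ₁ Λ₂ : Finset (Site 2), ∀ r : ℕ,
    (∀ u ∈ Λ₁, ∀ v ∈ Λ₂, (r : ℤ) ≤ max |u 0 - v 0| |u 1 - v 1|) →
    ∀ (A₁ : Set (Λ₁ → Prop)) (A₂ : Set (Λ₂ → Prop)),
      |μ.real ((obsOn S Λ₁) ⁻¹' A₁ ∩ (obsOn S Λ₂) ⁻¹' A₂) -
          μ.real ((obsOn S Λ₁) ⁻¹' A₁) * μ.real ((obsOn S Λ₂) ⁻¹' A₂)|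
        ≤ C * Λ₁.card * Real.exp (-c * r)

/-! ## Card B — XOR-corner quasi-invariance -/

/-- The observed pair (black cells, anti-diagonal faces). -/
def obs (S : Set ℤ) (ω : Ω) : Set (Site 2) × Set (Site 2) := ({v | blk S ω v}, {f | anti S ω f})

/-- XOR the colour component by the indicator of the cell rectangle `[x₁,x₂] × [y₁,y₂]`. -/
def xorRect (x₁ x₂ y₁ y₂ : ℤ) (p : Set (Site 2) × Set (Site 2)) : Set (Site 2) × Set (Site 2) :=
  ({v | Xor (v ∈ p.1) (x₁ ≤ v 0 ∧ v 0 ≤ x₂ ∧ y₁ ≤ v 1 ∧ v 1 ≤ y₂)}, p.2)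

/-- **First lemma of card B (named, not proved): XOR-corner quasi-invariance, uniform in `S`.**
Flipping all colours inside any cell rectangle changes plaquette parities only at its four corner
faces, each a Bernoulli(2√3-3) or fair bit of the gauge, so the joint law of (colours, diagonals)
moves by a density factor at most `(1/t)^4 = 16/9`, `t = √3/2`, whatever `S` and the rectangle. -/
def XorCornerQuasiInvariance : Prop :=
  ∀ S : Set ℤ, ∀ x₁ x₂ y₁ y₂ : ℤ, x₁ ≤ x₂ → y₁ ≤ y₂ →
    ∀ E : Set (Set (Site 2) × Set (Site 2)), MeasurableSet E →
      μ.real ((xorRect x₁ x₂ y₁ y₂ ∘ obs S) ⁻¹' E) ≤ (16 / 9) * μ.real ((obs S) ⁻¹' E)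

/-- Corollary shape used by the card (conditional duality in a rectangle `Q`, any outside event):
black left-right crossing of `Q` vs. absence of a black top-bottom crossing of `Q`. -/
def ConditionalDualityShape : Prop :=
  ∀ S : Set ℤ, ∀ x₁ x₂ y₁ y₂ : ℤ, x₁ ≤ x₂ → y₁ ≤ y₂ →
    ∀ Out : Set (Set (Site 2) × Set (Site 2)), MeasurableSet Out →
      (∀ p, p ∈ Out ↔ xorRect x₁ x₂ y₁ y₂ p ∈ Out) →
      let Q : Set (Site 2) := {v | x₁ ≤ v 0 ∧ v 0 ≤ x₂ ∧ y₁ ≤ v 1 ∧ v 1 ≤ y₂}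
      μ.real ({ω | edges S ω ∈ openCrossing Q {v | v ∈ Q ∧ v 0 = x₁} {v | v ∈ Q ∧ v 0 = x₂}} ∩ (obs S) ⁻¹' Out)
        ≤ (16 / 9) * μ.real ({ω | edges S ω ∉ openCrossing Q {v | v ∈ Q ∧ v 1 = y₁} {v | v ∈ Q ∧ v 1 = y₂}}
          ∩ (obs S) ⁻¹' Out)

/-! ## Card C — curtain independence -/

/-- Colours (and diagonals) weakly left of the cell column `x₀`. -/
def leftObs (S : Set ℤ) (x₀ : ℤ) (ω : Ω) : Set (Site 2) × Set (Site 2) :=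
  ({v | v 0 ≤ x₀ ∧ blk S ω v}, {f | f 0 < x₀ ∧ anti S ω f})

/-- Colours (and diagonals) strictly right of the cell column `x₀`. -/
def rightObs (S : Set ℤ) (x₀ : ℤ) (ω : Ω) : Set (Site 2) × Set (Site 2) :=
  ({v | x₀ < v 0 ∧ blk S ω v}, {f | x₀ < f 0 ∧ anti S ω f})

/-- **First lemma of card C (named, not proved): curtain independence.** If the face-column `x₀`
is a honeycomb column (`x₀ ∉ S`: fair plaquette bits, forced anti-diagonals), the configuration in
cell-columns `≤ x₀` is independent of the configuration in cell-columns `≥ x₀ + 1`: the innovation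
`σ(x₀+1,·) ⊕ σ(x₀,·) = A_{x₀} ⊕ A_{x₀+1} ⊕ (fair face-column walk)` is an i.i.d. fair one-time pad. -/
def CurtainIndependence : Prop :=
  ∀ S : Set ℤ, ∀ x₀ : ℤ, x₀ ∉ S → ProbabilityTheory.IndepFun (leftObs S x₀) (rightObs S x₀) μ

end Summit.CriticalPhenomena.CardyFormulaZ2.Cruxes.IKMixedBoxCrossing.Ideator3
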